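import Literature.MathematicalPhysics.QuantumFieldTheory.Balaban1983to89.Node00.Record13LettersOfThm1CCMW
import Literature.MathematicalPhysics.QuantumFieldTheory.Balaban1983to89.Node00.Record13SepCoPInhabitedOfThm1CCMGaugeR

/-!
# NODE 00 (YM-PLAN Track A) — STAGE 13: THE K0 BODIES (⁵ `SepCoP`, ⁶ `SepCoPR`, ⁷ `SepCoPH`) FOR `F` AT `N = 2` AT THE WINDOWED COLLARED WITNESS `θ₁₅ᶜᶜᴹ(j; γ)`, `0 < γ ≤ ½`,
# FROM THE GUARDED (8) `VariationalThm1RegSepCoP7MGB … (floorGuard F c) (lamDatum F) (dataSmall7PTopOf F N) …`, THE FLOOR-GUARDED (9)-STEP `Gauge9RegSepTopStepGB … (L^j) (floorGuard F c)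
# (lamDatum F) (dataSmall7PTopOf F N) …` (`c ≤ L^j`), THE TWO HISTORY CLAUSES — or THE β-BOX OF A1's WITNESS `θ₁₅ᶜᶜᴹ(j)` ON THE SMALLER BOX `]0, γ]` with the letter `β′·γ² ≤ ¾` — AND
# THE SIGNS, UNDER `j + 1 ≤ F.m` — STAGE-2 EDITION AT PRINT's (2.3) DATUM

Cell `pub-ymgap`, seat `pub-ymgap-dag-n21-c` (g12), pen (γ) on plan g76's V15 stub 3′ `stub_betaBoxAtThm1WitnessCCM13`.  FILE Bʷ of the window edition (A1ʷ `Record13NumericsOfThm1CCMW`,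
A2ʷ `Record13LettersOfThm1CCMW`).  NEW leaf, theorems only; B `Record13SepCoPInhabitedOfThm1CCMGaugeR` (g11), B′ `Record12BgRowCoClassGaugeR` (§5 socket, §4 «minimal ⇒ critical»),
node00-def-K0a's 16a ∕ 18, node00-def-T's history-blind door and the guarded `(bd, Dat)` ᴮ tokens (`Record12BgRowCoClassCPMFloorB` ∕ `…GaugeRGuardedB` ∕ `TorusCoverGaugeTokensGuardedB`)
CONSUMED BY NAME, nothing modified.  `--supports stmt-QuantumFields-20541`.
[15] = [Balaban1985Variational]; [6] = [Balaban1985RegularSpaces]; [III] = [Balaban1988Convergent]; [I] = [Balaban1987RG1]; [II] = [Balaban1989LargeFieldII]; [IV] = [Balaban1989LargeFieldI].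

STAGE-2 RE-KEY (node00-def-T g25, S1d CHAIN B2 by node00-def-K0a's assignment ∕ recipe, director-ym №346 ∕ №352): (E1) Stage-2 coherence re-key to print's (2.3) datum (FLAG №16 ∕ LOCATE-HSEAM
5d3298b8d191f169); the (b)-keyed text survives in git history.  As in B `Record13SepCoPInhabitedOfThm1CCMGaugeR` (CHAIN B1): every displayed (8) ∕ (9) ∕ step token is the GUARDED `(bd, Dat)`
ᴮ token at `(floorGuard F c, lamDatum F, dataSmall7PTopOf F N)` — (8) `VariationalThm1RegSepCoP7MGB F N (floorGuard F c) (lamDatum F) (dataSmall7PTopOf F N) B₃ a₀ a₁`, (9)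
`VariationalThm1GaugeRegSepCoP7MGB F N (F.L ^ j) (floorGuard F c) (lamDatum F) (dataSmall7PTopOf F N) B₃ B₃' a₀ a₁` (from the step token by `variationalThm1GaugeRegSepCoP7MGB_of_gauge9TopStepGB`),
step `Gauge9RegSepTopStepGB F N suppDom (F.L ^ j) (floorGuard F c) (lamDatum F) (dataSmall7PTopOf F N) B₃ B₃' a₀ a₁` (cube: `floorGuard F ((11·4 + 3·L)·L)`); at level `n+1` the carrier
`UbgOfRecord₁₃CoP_succ` IS node00-def-R's `UbgMSCoPOfRecordB …` (`LargeFieldBackgroundCoPOfRecordB`, Stage-2 seam edit of `Record13CoP`) and the row is `Record12BgRowCoClassGaugeRGuardedBRow`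
§3 `Stage13Params.bgAtDatumBg_of_thm1RegSepCoP7MGB_of_thm1GaugeGB` with `Ubg := UbgMSCoPOfRecordB …`, `hbg := ubgMSCoPOfRecordB_dichotomy …` inlined, guard `c ≤ M₁ = L^j` from `hc`.
Declaration NAMES unchanged (the `R` in them is historical); «(8) ∕ the R gauge sentence ∕ the R step fact» below denote these ᴮ tokens.  Re-keying bookkeeping only — nothing of Bałaban
asserted.

WHY.  B's closers read the β-box of `betaOfRecord₁₃ F 2 θ₁₅ᶜᶜᴹ(j)` on the FIXED window `]0, ½]` with `β′ ≤ 3` (V15 stub 3′).  NODE O's typed roads deliver β-bounds on SOME window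
`]0, γ₀]`, `γ₀` small (K2's registered pair: `∃ γ₀ ≤ θ.γ, …`; [I] Thm 1 ∕ §1 p.264: «γ sufficiently small»; [II] p.355 ∕ (1.4) p.357: positivity «for g_k small»).  The K0 provisos read the
window only through `Step.InInterval θ.γ`; at the window edition `θ₁₅ᶜᶜᴹ(j; γ)` (`θ.γ = γ`) every gauge-road letter survives for `γ ≤ ½` (A2ʷ §3), the pins ∕ collar ∕ non-wrapping letters
are window-blind (A2ʷ §4), and ON `]0, γ]` the β of record of `θ₁₅ᶜᶜᴹ(j; γ)` IS that of `θ₁₅ᶜᶜᴹ(j)` (A2ʷ §5 transfer).  So the ⁷ K0 body for `F` follows from the SAME tokens as B's and a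
β-box of A1's witness on ANY window `]0, γ] ⊆ ]0, ½]` — the weakening of stub 3′ from «the box `½`, `β′ ≤ 3`» to «some box `γ ∈ ]0, ½]`, `β′·γ² ≤ ¾`» (Cʷ states it at the cube).

WHAT THIS FILE PROVES (theorems only; 0 `def`).
§1 ★★★ `bgSepCoPAt_theta13OfThm1CCMW_of_thm1GaugeR (hγ0 : 0 < γ) (hγ : γ ≤ ½) (hjm : j + 1 ≤ F.m) (signs) (h15) (hc : c ≤ F.L ^ j) (h15G) (hmono) (hcompRev)` ⊢ 16a's (7)-guarded
   row-P11 clause at `θ₁₅ᶜᶜᴹ(j; γ)` (`Record12BgRowCoClassGaugeRGuardedBRow` §3 at `UbgMSCoPOfRecordB` with A2ʷ's letters); ★★ `provisos₁₃SepCoP_theta13OfThm1CCMW_of_thm1GaugeR`.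
§2 CLOSERS (`N = 2`), each under `0 < γ ≤ ½`, `j + 1 ≤ F.m` and the signs: ⁵ `exists_k0SepCoP_thm1CCMW_of_thm1GaugeR (hmono) (hcompRev)`; its ⁶ ∕ ⁷ images
   `exists_k0SepCoPR_thm1CCMW_of_thm1GaugeR`, `exists_k0SepCoPH_thm1CCMW_of_thm1GaugeR`; keyed on the R step fact `exists_k0SepCoPH_thm1CCMW_of_gauge9TopStepR (h9) (hmono) (hcompRev)`;
   ★ from the β-box ON `]0, γ]` of the window edition `…_of_gauge9TopStepR_of_betaBox (hb : 0 ≤ b) (hlow) (hup) (hletter : β′·γ² ≤ ¾)`; ★★ from the β-box ON `]0, γ]` OF A1's WITNESS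
   `…_of_gauge9TopStepR_of_betaBox_half`; and the V15-facing cube instances (`j = 3`, `M = L³`, `c = (11·4 + 3L)·L`, `4 ≤ F.m`) `…_of_betaBox_half_cube`, `…_of_clauses_cube`.
   What remains displayed: (8), the R step fact, the signs, `j + 1 ≤ F.m`, and EITHER the two history clauses at `θ₁₅ᶜᶜᴹ(j; γ)` OR the β-box of `betaOfRecord₁₃ F 2 θ₁₅ᶜᶜᴹ(j)` on `]0, γ]`
   for SOME `γ ∈ ]0, ½]` — NODE O's input in the shape its roads produce.

HONEST FRAMING.  Compositions of tree theorems; CONDITIONAL on the displayed named facts (`Prop`s with parameters, NEVER asserted) and on the β-box ∕ history clauses; nothing of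
Bałaban asserted or discharged; K0⁷ NOT closed here (V15 stubs 1∕2∕3′∕4 untouched; this file SUPPLIES the weaker stub 3ʷ's road); counts unmoved (typed 28∕28 · discharged 5∕27);
one finite 𝕋⁴ programme at fixed ε — NOT continuum ∕ OS ∕ mass gap ∕ Clay.  No `sorry`, `axiom`, `def`, `instance`, `notation`.
-/

noncomputable section

open MeasureTheory
open scoped Matrix.Norms.L2Operator

namespace Literature.MathematicalPhysics.QuantumFieldTheory.Balaban1983to89.Node00

open T4Continuum B14.Eq218Concrete B15DeterminingSets FlowStep FlowStepRuns B12RegularSpaces111 B14RegularSpaces234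

/-! ## §1. ★★★ At `θ₁₅ᶜᶜᴹ(j; γ)`: the (7)-guarded separated row P11 at the Co carrier from (8), the R gauge sentence and the two history clauses -/

section AtWitnessGaugeRW

variable {F : T4Family} {N : ℕ} [NeZero N] {j c : ℕ} {γ ε₀ ε₂₉ B₃ B₃' a₀ a₁ : ℝ}

/-- **★★★ THE (7)-GUARDED SEPARATED ROW P11 AT THE Co CARRIER AT `θ₁₅ᶜᶜᴹ(j; γ)`, PER PARTITION-COMPATIBLE RUN, FROM (8) `VariationalThm1RegSepCoP7MGB F N (floorGuard F c) (lamDatum F) (dataSmall7PTopOf F N) B₃ a₀ a₁`, THE R GAUGE SENTENCE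
`VariationalThm1GaugeRegSepCoP7MGB F N (F.L ^ j) (floorGuard F c) (lamDatum F) (dataSmall7PTopOf F N) B₃ B₃' a₀ a₁` AT A FLOOR `c ≤ F.L ^ j = M₁`, AND THE TWO HISTORY CLAUSES**, under `0 < γ ≤ ½` and `j + 1 ≤ F.m`: at level `n+1` the carrier IS
def-R's collar-class minimiser at print's (2.3) datum `UbgMSCoPOfRecordB` (`UbgOfRecord₁₃CoP_succ`, Stage 2) and `Record12BgRowCoClassGaugeRGuardedBRow` §3 applies (`Ubg := UbgMSCoPOfRecordB`,
`hbg := ubgMSCoPOfRecordB_dichotomy`, guard `floorGuard F c` from `hc`) with A2ʷ's letters; level `0` is vacuous.  16a's hypothesis `hbgSepCoP` VERBATIM.  CONDITIONAL; nothing of Bałaban asserted.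
[cite: Balaban1985Variational, (6)–(7) p.278, Thm 1 (8)–(9) p.279, (144)–(152) pp.300–301, Prop. 8 p.304; Balaban1985RegularSpaces, (1.3)–(1.9) p.77, Prop. 6 p.99; Balaban1988Convergent, Thm 1 p.262, (2.4)–(2.8) pp.255–256, (2.12)–(2.13) pp.256–257, (2.27)–(2.28) p.259, (2.34)–(2.41) p.261, (3.16)–(3.22) pp.268–269; Balaban1987RG1, Thm 1 p.259, (0.1) p.251, (1.11)–(1.12) p.262; Balaban1989LargeFieldI, (0.3)–(0.4) p.176] -/
theorem bgSepCoPAt_theta13OfThm1CCMW_of_thm1GaugeR (hγ0 : 0 < γ) (hγ : γ ≤ 1 / 2) (hjm : j + 1 ≤ F.m) (hε : 0 < ε₀) (hε' : 0 < ε₂₉) (hB : 0 ≤ B₃) (hB' : 0 ≤ B₃') (ha₀ : 0 < a₀) (ha₁ : 0 < a₁)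
    (h15 : VariationalThm1RegSepCoP7MGB F N (floorGuard F c) (lamDatum F) (dataSmall7PTopOf F N) B₃ a₀ a₁) (hc : c ≤ F.L ^ j) (h15G : VariationalThm1GaugeRegSepCoP7MGB F N (F.L ^ j) (floorGuard F c) (lamDatum F) (dataSmall7PTopOf F N) B₃ B₃' a₀ a₁)
    (hmono : ∀ (p : B12.RunParams) (n : ℕ), n ≤ p.K → Step.InInterval (theta13OfThm1CCMW F N j γ ε₀ ε₂₉ B₃ B₃' a₀ a₁).γ n (gOfRecord₁₃ F N (theta13OfThm1CCMW F N j γ ε₀ ε₂₉ B₃ B₃' a₀ a₁) p) → ∀ m, m < n →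
      gOfRecord₁₃ F N (theta13OfThm1CCMW F N j γ ε₀ ε₂₉ B₃ B₃' a₀ a₁) p m ≤ gOfRecord₁₃ F N (theta13OfThm1CCMW F N j γ ε₀ ε₂₉ B₃ B₃' a₀ a₁) p (m + 1))
    (hcompRev : ∀ (p : B12.RunParams) (n : ℕ), n ≤ p.K → Step.InInterval (theta13OfThm1CCMW F N j γ ε₀ ε₂₉ B₃ B₃' a₀ a₁).γ n (gOfRecord₁₃ F N (theta13OfThm1CCMW F N j γ ε₀ ε₂₉ B₃ B₃' a₀ a₁) p) → ∀ m, m < n →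
      (theta13OfThm1CCMW F N j γ ε₀ ε₂₉ B₃ B₃' a₀ a₁).s2.cR * epsOfRecord (theta13OfThm1CCMW F N j γ ε₀ ε₂₉ B₃ B₃' a₀ a₁).ν (gOfRecord₁₃ F N (theta13OfThm1CCMW F N j γ ε₀ ε₂₉ B₃ B₃' a₀ a₁) p) (m + 1) ≤ 2 * ((theta13OfThm1CCMW F N j γ ε₀ ε₂₉ B₃ B₃' a₀ a₁).s2.cR * epsOfRecord (theta13OfThm1CCMW F N j γ ε₀ ε₂₉ B₃ B₃' a₀ a₁).ν (gOfRecord₁₃ F N (theta13OfThm1CCMW F N j γ ε₀ ε₂₉ B₃ B₃' a₀ a₁) p) m)) :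
    ∀ (p : B12.RunParams) (n : ℕ), n ≤ p.K → Step.InInterval (theta13OfThm1CCMW F N j γ ε₀ ε₂₉ B₃ B₃' a₀ a₁).γ n (gOfRecord₁₃ F N (theta13OfThm1CCMW F N j γ ε₀ ε₂₉ B₃ B₃' a₀ a₁) p) → PartCompat₁₃ F N (theta13OfThm1CCMW F N j γ ε₀ ε₂₉ B₃ B₃' a₀ a₁) p n →
      ∀ s : SeqOfRecord F (theta13OfThm1CCMW F N j γ ε₀ ε₂₉ B₃ B₃' a₀ a₁).ν (theta13OfThm1CCMW F N j γ ε₀ ε₂₉ B₃ B₃' a₀ a₁).τ9.M (gOfRecord₁₃ F N (theta13OfThm1CCMW F N j γ ε₀ ε₂₉ B₃ B₃' a₀ a₁) p) p.K n, Sect2.SeqSeparated (theta13OfThm1CCMW F N j γ ε₀ ε₂₉ B₃ B₃' a₀ a₁).ν.M₁ s →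
      ∀ W : MSField (F.P p.K) (SU N), W ∈ suppOfRecord₁₃P F N (theta13OfThm1CCMW F N j γ ε₀ ε₂₉ B₃ B₃' a₀ a₁) p n s →
      Sect2.DataSmall7PTop (avOfRecord F N p.K) s.Ω (suppDomOfRecord F (theta13OfThm1CCMW F N j γ ε₀ ε₂₉ B₃ B₃' a₀ a₁).ν p.K s.Ω) n (fun j' => (theta13OfThm1CCMW F N j γ ε₀ ε₂₉ B₃ B₃' a₀ a₁).s2.cR * epsOfRecord (theta13OfThm1CCMW F N j γ ε₀ ε₂₉ B₃ B₃' a₀ a₁).ν (gOfRecord₁₃ F N (theta13OfThm1CCMW F N j γ ε₀ ε₂₉ B₃ B₃' a₀ a₁) p) j') W →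
      ∀ j', 1 ≤ j' → j' ≤ n → ∀ X : (Sect2.domSys (F.P p.K) (theta13OfThm1CCMW F N j γ ε₀ ε₂₉ B₃ B₃' a₀ a₁).τ9.M j').Dom,
      (Sect2.domSites (F.P p.K) (theta13OfThm1CCMW F N j γ ε₀ ε₂₉ B₃ B₃' a₀ a₁).τ9.M j' X ⊆ s.Λ j' →
        Sect2.ofBackgroundC (settingOfRecord₁₃ F N (theta13OfThm1CCMW F N j γ ε₀ ε₂₉ B₃ B₃' a₀ a₁) p).ι (UbgOfRecord₁₃CoP F N (theta13OfThm1CCMW F N j γ ε₀ ε₂₉ B₃ B₃' a₀ a₁) p n s W) ∈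
          Sect2.spaceI (settingOfRecord₁₃ F N (theta13OfThm1CCMW F N j γ ε₀ ε₂₉ B₃ B₃' a₀ a₁) p) ((theta13OfThm1CCMW F N j γ ε₀ ε₂₉ B₃ B₃' a₀ a₁).Rz p.K) (theta13OfThm1CCMW F N j γ ε₀ ε₂₉ B₃ B₃' a₀ a₁).τ9.M j' (Sect2.domSites (F.P p.K) (theta13OfThm1CCMW F N j γ ε₀ ε₂₉ B₃ B₃' a₀ a₁).τ9.M j' X)
            ((settingOfRecord₁₃ F N (theta13OfThm1CCMW F N j γ ε₀ ε₂₉ B₃ B₃' a₀ a₁) p).lf.alpha0 ((settingOfRecord₁₃ F N (theta13OfThm1CCMW F N j γ ε₀ ε₂₉ B₃ B₃' a₀ a₁) p).flow.g j')) ((settingOfRecord₁₃ F N (theta13OfThm1CCMW F N j γ ε₀ ε₂₉ B₃ B₃' a₀ a₁) p).lf.alpha1 ((settingOfRecord₁₃ F N (theta13OfThm1CCMW F N j γ ε₀ ε₂₉ B₃ B₃' a₀ a₁) p).flow.g j'))) ∧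
      (Sect2.admB (F.P p.K) (theta13OfThm1CCMW F N j γ ε₀ ε₂₉ B₃ B₃' a₀ a₁).ν (theta13OfThm1CCMW F N j γ ε₀ ε₂₉ B₃ B₃' a₀ a₁).τ9.M (gOfRecord₁₃ F N (theta13OfThm1CCMW F N j γ ε₀ ε₂₉ B₃ B₃' a₀ a₁) p) s.Ω s.Λ j' (Sect2.domSites (F.P p.K) (theta13OfThm1CCMW F N j γ ε₀ ε₂₉ B₃ B₃' a₀ a₁).τ9.M j' X) = true →
        Sect2.ofBackgroundC (settingOfRecord₁₃ F N (theta13OfThm1CCMW F N j γ ε₀ ε₂₉ B₃ B₃' a₀ a₁) p).ι (UbgOfRecord₁₃CoP F N (theta13OfThm1CCMW F N j γ ε₀ ε₂₉ B₃ B₃' a₀ a₁) p n s W) ∈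
          Sect2.spaceMS (settingOfRecord₁₃ F N (theta13OfThm1CCMW F N j γ ε₀ ε₂₉ B₃ B₃' a₀ a₁) p) ((theta13OfThm1CCMW F N j γ ε₀ ε₂₉ B₃ B₃' a₀ a₁).Rz p.K) (theta13OfThm1CCMW F N j γ ε₀ ε₂₉ B₃ B₃' a₀ a₁).τ9.M j' (Sect2.domSites (F.P p.K) (theta13OfThm1CCMW F N j γ ε₀ ε₂₉ B₃ B₃' a₀ a₁).τ9.M j' X) s.Ω) := by
  intro p n hn hw hpc s hsep W _ h7
  cases n with
  | zero => intro j' h1 hj'; exfalso; omega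
  | succ n =>
    rw [UbgOfRecord₁₃CoP_succ]
    exact (theta13OfThm1CCMW F N j γ ε₀ ε₂₉ B₃ B₃' a₀ a₁).bgAtDatumBg_of_thm1RegSepCoP7MGB_of_thm1GaugeGB (admissible_theta13OfThm1CCMW_of_le_half F N hγ0 hγ hε hε' hB hB' ha₀ ha₁) rfl
      (τ9_M_pos_theta13OfThm1CCMW F N j γ ε₀ ε₂₉ B₃ B₃' a₀ a₁) h15 h15G
      (fun p n s W => UbgMSCoPOfRecordB F N (theta13OfThm1CCMW F N j γ ε₀ ε₂₉ B₃ B₃' a₀ a₁).ν (theta13OfThm1CCMW F N j γ ε₀ ε₂₉ B₃ B₃' a₀ a₁).τ9.M (gOfRecord₁₃ F N (theta13OfThm1CCMW F N j γ ε₀ ε₂₉ B₃ B₃' a₀ a₁) p) p.K n s W)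
      (fun p n s W => ubgMSCoPOfRecordB_dichotomy (theta13OfThm1CCMW F N j γ ε₀ ε₂₉ B₃ B₃' a₀ a₁).ν (theta13OfThm1CCMW F N j γ ε₀ ε₂₉ B₃ B₃' a₀ a₁).τ9.M (gOfRecord₁₃ F N (theta13OfThm1CCMW F N j γ ε₀ ε₂₉ B₃ B₃' a₀ a₁) p) p.K n s W)
      (hnum_theta13OfThm1CCMW hγ hB hB' ha₀ ha₁) εreg_le_theta13OfThm1CCMW
      (hcomp_theta13OfThm1CCMW_of_monotone hγ hB hB' ha₀.le ha₁.le hmono) hcompRev (hBα_theta13OfThm1CCMW hγ hB hB' ha₀.le ha₁.le)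
      (htI_theta13OfThm1CCMW hγ hB hB' ha₀.le ha₁.le) (htMS_theta13OfThm1CCMW hγ hB hB' ha₀.le ha₁.le) (hC1_theta13OfThm1CCMW hγ) (hsN_theta13OfThm1CCMW F N γ ε₀ ε₂₉ B₃ B₃' a₀ a₁ hjm)
      p (n + 1) hn hw hpc s hsep (M₁_pos_theta13OfThm1CCMW F N j γ ε₀ ε₂₉ B₃ B₃' a₀ a₁) (show c ≤ (theta13OfThm1CCMW F N j γ ε₀ ε₂₉ B₃ B₃' a₀ a₁).ν.M₁ by rw [theta13OfThm1CCMW_M₁]; exact hc) W h7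

/-- **★★ THE v1.5 PROVISOS OF RECORD AT `θ₁₅ᶜᶜᴹ(j; γ)`** from `0 < γ ≤ ½`, the signs, (8), the R gauge sentence and the two history clauses, under `j + 1 ≤ F.m` (16a's
`provisos₁₃SepCoP_theta13LiveOfNumerics_of_bgSepCoP` ∘ ★★★; pins `M = L^j`, `M₁ = L^j ∣ M`). [cite: Balaban1985Variational, (6)–(7) p.278, Thm 1 (8)–(9) p.279, (152) p.301, Prop. 8 p.304; Balaban1985RegularSpaces, (1.3)–(1.9) p.77; Balaban1988Convergent, Thm 1 p.262, (2.4)–(2.8) pp.255–256, (2.12)–(2.13) pp.256–257, (2.18) p.257, (2.27)–(2.28) p.259, (2.34)–(2.41) p.261, (3.16)–(3.22) pp.268–269; Balaban1987RG1, Thm 1 p.259, (1.11)–(1.12) p.262; Balaban1989LargeFieldI, (0.3)–(0.4) p.176] -/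
theorem provisos₁₃SepCoP_theta13OfThm1CCMW_of_thm1GaugeR (hγ0 : 0 < γ) (hγ : γ ≤ 1 / 2) (hjm : j + 1 ≤ F.m) (hε : 0 < ε₀) (hε' : 0 < ε₂₉) (hB : 0 ≤ B₃) (hB' : 0 ≤ B₃') (ha₀ : 0 < a₀) (ha₁ : 0 < a₁)
    (h15 : VariationalThm1RegSepCoP7MGB F N (floorGuard F c) (lamDatum F) (dataSmall7PTopOf F N) B₃ a₀ a₁) (hc : c ≤ F.L ^ j) (h15G : VariationalThm1GaugeRegSepCoP7MGB F N (F.L ^ j) (floorGuard F c) (lamDatum F) (dataSmall7PTopOf F N) B₃ B₃' a₀ a₁)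
    (hmono : ∀ (p : B12.RunParams) (n : ℕ), n ≤ p.K → Step.InInterval (theta13OfThm1CCMW F N j γ ε₀ ε₂₉ B₃ B₃' a₀ a₁).γ n (gOfRecord₁₃ F N (theta13OfThm1CCMW F N j γ ε₀ ε₂₉ B₃ B₃' a₀ a₁) p) → ∀ m, m < n →
      gOfRecord₁₃ F N (theta13OfThm1CCMW F N j γ ε₀ ε₂₉ B₃ B₃' a₀ a₁) p m ≤ gOfRecord₁₃ F N (theta13OfThm1CCMW F N j γ ε₀ ε₂₉ B₃ B₃' a₀ a₁) p (m + 1))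
    (hcompRev : ∀ (p : B12.RunParams) (n : ℕ), n ≤ p.K → Step.InInterval (theta13OfThm1CCMW F N j γ ε₀ ε₂₉ B₃ B₃' a₀ a₁).γ n (gOfRecord₁₃ F N (theta13OfThm1CCMW F N j γ ε₀ ε₂₉ B₃ B₃' a₀ a₁) p) → ∀ m, m < n →
      (theta13OfThm1CCMW F N j γ ε₀ ε₂₉ B₃ B₃' a₀ a₁).s2.cR * epsOfRecord (theta13OfThm1CCMW F N j γ ε₀ ε₂₉ B₃ B₃' a₀ a₁).ν (gOfRecord₁₃ F N (theta13OfThm1CCMW F N j γ ε₀ ε₂₉ B₃ B₃' a₀ a₁) p) (m + 1) ≤ 2 * ((theta13OfThm1CCMW F N j γ ε₀ ε₂₉ B₃ B₃' a₀ a₁).s2.cR * epsOfRecord (theta13OfThm1CCMW F N j γ ε₀ ε₂₉ B₃ B₃' a₀ a₁).ν (gOfRecord₁₃ F N (theta13OfThm1CCMW F N j γ ε₀ ε₂₉ B₃ B₃' a₀ a₁) p) m)) :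
    (theta13OfThm1CCMW F N j γ ε₀ ε₂₉ B₃ B₃' a₀ a₁).Provisos₁₃SepCoP F N :=
  provisos₁₃SepCoP_theta13LiveOfNumerics_of_bgSepCoP F N (stage12NumericsOfThm1CCMW F.L j γ ε₀ B₃ B₃' a₀ a₁) ε₂₉ ⟨j, rfl⟩ (dvd_refl _)
    (bgSepCoPAt_theta13OfThm1CCMW_of_thm1GaugeR hγ0 hγ hjm hε hε' hB hB' ha₀ ha₁ h15 hc h15G hmono hcompRev)

end AtWitnessGaugeRW

/-! ## §2. Closers at the window edition: the ⁵ ∕ ⁶ ∕ ⁷ K0 bodies for `F` at `N = 2` from (8), the R gauge sentence ∕ the R step fact, and the history clauses ∕ the β-box on `]0, γ]` -/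

section ClosersGaugeRW

variable {j c : ℕ} {γ ε₀ ε₂₉ B₃ B₃' a₀ a₁ : ℝ}

/-- **★★★★★ THE v1.5 K0 BODY (⁵) FOR `F` AT `N = 2` AT `θ₁₅ᶜᶜᴹ(j; γ)` FROM (8), THE R GAUGE SENTENCE AT A FLOOR `c ≤ F.L ^ j`, AND THE TWO HISTORY CLAUSES** (`0 < γ ≤ ½`, `j + 1 ≤ F.m`):
16a's socket ∘ §1.  CONDITIONAL — nothing of Bałaban asserted; K0 NOT closed here. [cite: Balaban1985Variational, (6)–(7) p.278, Thm 1 (8)–(9) p.279, (152) p.301, Prop. 8 p.304; Balaban1985RegularSpaces, (1.3)–(1.9) p.77, Prop. 6 p.99; Balaban1988Convergent, Thm 1 p.262, (2.4)–(2.8) pp.255–256, (2.12)–(2.13) pp.256–257, (2.27)–(2.28) p.259, (2.34)–(2.41) p.261, (3.16)–(3.22) pp.268–269; Balaban1987RG1, Thm 1 p.259, (1.11)–(1.12) p.262; Balaban1989LargeFieldI, (0.3)–(0.4) p.176] -/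
theorem exists_k0SepCoP_thm1CCMW_of_thm1GaugeR (F : T4Family) (hγ0 : 0 < γ) (hγ : γ ≤ 1 / 2) (hjm : j + 1 ≤ F.m) (hε : 0 < ε₀) (hε' : 0 < ε₂₉) (hB : 0 ≤ B₃) (hB' : 0 ≤ B₃') (ha₀ : 0 < a₀) (ha₁ : 0 < a₁)
    (h15 : VariationalThm1RegSepCoP7MGB F 2 (floorGuard F c) (lamDatum F) (dataSmall7PTopOf F 2) B₃ a₀ a₁) (hc : c ≤ F.L ^ j) (h15G : VariationalThm1GaugeRegSepCoP7MGB F 2 (F.L ^ j) (floorGuard F c) (lamDatum F) (dataSmall7PTopOf F 2) B₃ B₃' a₀ a₁)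
    (hmono : ∀ (p : B12.RunParams) (n : ℕ), n ≤ p.K → Step.InInterval (theta13OfThm1CCMW F 2 j γ ε₀ ε₂₉ B₃ B₃' a₀ a₁).γ n (gOfRecord₁₃ F 2 (theta13OfThm1CCMW F 2 j γ ε₀ ε₂₉ B₃ B₃' a₀ a₁) p) → ∀ m, m < n →
      gOfRecord₁₃ F 2 (theta13OfThm1CCMW F 2 j γ ε₀ ε₂₉ B₃ B₃' a₀ a₁) p m ≤ gOfRecord₁₃ F 2 (theta13OfThm1CCMW F 2 j γ ε₀ ε₂₉ B₃ B₃' a₀ a₁) p (m + 1))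
    (hcompRev : ∀ (p : B12.RunParams) (n : ℕ), n ≤ p.K → Step.InInterval (theta13OfThm1CCMW F 2 j γ ε₀ ε₂₉ B₃ B₃' a₀ a₁).γ n (gOfRecord₁₃ F 2 (theta13OfThm1CCMW F 2 j γ ε₀ ε₂₉ B₃ B₃' a₀ a₁) p) → ∀ m, m < n →
      (theta13OfThm1CCMW F 2 j γ ε₀ ε₂₉ B₃ B₃' a₀ a₁).s2.cR * epsOfRecord (theta13OfThm1CCMW F 2 j γ ε₀ ε₂₉ B₃ B₃' a₀ a₁).ν (gOfRecord₁₃ F 2 (theta13OfThm1CCMW F 2 j γ ε₀ ε₂₉ B₃ B₃' a₀ a₁) p) (m + 1) ≤ 2 * ((theta13OfThm1CCMW F 2 j γ ε₀ ε₂₉ B₃ B₃' a₀ a₁).s2.cR * epsOfRecord (theta13OfThm1CCMW F 2 j γ ε₀ ε₂₉ B₃ B₃' a₀ a₁).ν (gOfRecord₁₃ F 2 (theta13OfThm1CCMW F 2 j γ ε₀ ε₂₉ B₃ B₃' a₀ a₁) p) m)) :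
    ∃ θ : Stage13Params F 2, θ.Provisos₁₃SepCoP F 2 ∧ (θ.ZtUnity F 2 ∧ θ.SlotsNondegenerate₁₃ F 2) ∧ θ.Admissible F 2 :=
  exists_k0SepCoP_of_bgSepCoP_theta13LiveOfNumerics F (stage12NumericsOfThm1CCMW_pos_of_le_half (L := F.L) (j := j) F.hL.2.le hγ0 hγ hε hB hB' ha₀ ha₁) hε' ⟨j, rfl⟩ (dvd_refl _)
    (bgSepCoPAt_theta13OfThm1CCMW_of_thm1GaugeR hγ0 hγ hjm hε hε' hB hB' ha₀ ha₁ h15 hc h15G hmono hcompRev)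

/-- **THE ⁶ IMAGE** (FILE 18's cured lift). [cite: Balaban1985Variational, Thm 1 (8)–(9) p.279, Prop. 8 p.304; Balaban1988Convergent, Thm 1 p.262, (2.12)–(2.13) pp.256–257, (3.16)–(3.22) pp.268–269; Balaban1989LargeFieldI, (0.3)–(0.4) p.176] -/
theorem exists_k0SepCoPR_thm1CCMW_of_thm1GaugeR (F : T4Family) (hγ0 : 0 < γ) (hγ : γ ≤ 1 / 2) (hjm : j + 1 ≤ F.m) (hε : 0 < ε₀) (hε' : 0 < ε₂₉) (hB : 0 ≤ B₃) (hB' : 0 ≤ B₃') (ha₀ : 0 < a₀) (ha₁ : 0 < a₁)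
    (h15 : VariationalThm1RegSepCoP7MGB F 2 (floorGuard F c) (lamDatum F) (dataSmall7PTopOf F 2) B₃ a₀ a₁) (hc : c ≤ F.L ^ j) (h15G : VariationalThm1GaugeRegSepCoP7MGB F 2 (F.L ^ j) (floorGuard F c) (lamDatum F) (dataSmall7PTopOf F 2) B₃ B₃' a₀ a₁)
    (hmono : ∀ (p : B12.RunParams) (n : ℕ), n ≤ p.K → Step.InInterval (theta13OfThm1CCMW F 2 j γ ε₀ ε₂₉ B₃ B₃' a₀ a₁).γ n (gOfRecord₁₃ F 2 (theta13OfThm1CCMW F 2 j γ ε₀ ε₂₉ B₃ B₃' a₀ a₁) p) → ∀ m, m < n →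
      gOfRecord₁₃ F 2 (theta13OfThm1CCMW F 2 j γ ε₀ ε₂₉ B₃ B₃' a₀ a₁) p m ≤ gOfRecord₁₃ F 2 (theta13OfThm1CCMW F 2 j γ ε₀ ε₂₉ B₃ B₃' a₀ a₁) p (m + 1))
    (hcompRev : ∀ (p : B12.RunParams) (n : ℕ), n ≤ p.K → Step.InInterval (theta13OfThm1CCMW F 2 j γ ε₀ ε₂₉ B₃ B₃' a₀ a₁).γ n (gOfRecord₁₃ F 2 (theta13OfThm1CCMW F 2 j γ ε₀ ε₂₉ B₃ B₃' a₀ a₁) p) → ∀ m, m < n →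
      (theta13OfThm1CCMW F 2 j γ ε₀ ε₂₉ B₃ B₃' a₀ a₁).s2.cR * epsOfRecord (theta13OfThm1CCMW F 2 j γ ε₀ ε₂₉ B₃ B₃' a₀ a₁).ν (gOfRecord₁₃ F 2 (theta13OfThm1CCMW F 2 j γ ε₀ ε₂₉ B₃ B₃' a₀ a₁) p) (m + 1) ≤ 2 * ((theta13OfThm1CCMW F 2 j γ ε₀ ε₂₉ B₃ B₃' a₀ a₁).s2.cR * epsOfRecord (theta13OfThm1CCMW F 2 j γ ε₀ ε₂₉ B₃ B₃' a₀ a₁).ν (gOfRecord₁₃ F 2 (theta13OfThm1CCMW F 2 j γ ε₀ ε₂₉ B₃ B₃' a₀ a₁) p) m)) :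
    ∃ θ : Stage13RParams F 2, θ.Provisos₁₃SepCoPR F 2 ∧ (θ.ZrUnity F 2 ∧ θ.SlotsNondegenerate₁₃ F 2) ∧ θ.Admissible F 2 :=
  exists_k0SepCoPR_of_exists_k0SepCoP F (exists_k0SepCoP_thm1CCMW_of_thm1GaugeR F hγ0 hγ hjm hε hε' hB hB' ha₀ ha₁ h15 hc h15G hmono hcompRev)

/-- **THE ⁷ IMAGE** — K0⁷ `Record13SepCoPHInhabited`'s body for `F` (history-blind door). [cite: Balaban1985Variational, Thm 1 (8)–(9) p.279, Prop. 8 p.304; Balaban1988Convergent, Thm 1 p.262, (2.21) p.258, (3.16)–(3.23) pp.268–270; Balaban1989LargeFieldI, (0.2)–(0.4) p.176] -/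
theorem exists_k0SepCoPH_thm1CCMW_of_thm1GaugeR (F : T4Family) (hγ0 : 0 < γ) (hγ : γ ≤ 1 / 2) (hjm : j + 1 ≤ F.m) (hε : 0 < ε₀) (hε' : 0 < ε₂₉) (hB : 0 ≤ B₃) (hB' : 0 ≤ B₃') (ha₀ : 0 < a₀) (ha₁ : 0 < a₁)
    (h15 : VariationalThm1RegSepCoP7MGB F 2 (floorGuard F c) (lamDatum F) (dataSmall7PTopOf F 2) B₃ a₀ a₁) (hc : c ≤ F.L ^ j) (h15G : VariationalThm1GaugeRegSepCoP7MGB F 2 (F.L ^ j) (floorGuard F c) (lamDatum F) (dataSmall7PTopOf F 2) B₃ B₃' a₀ a₁)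
    (hmono : ∀ (p : B12.RunParams) (n : ℕ), n ≤ p.K → Step.InInterval (theta13OfThm1CCMW F 2 j γ ε₀ ε₂₉ B₃ B₃' a₀ a₁).γ n (gOfRecord₁₃ F 2 (theta13OfThm1CCMW F 2 j γ ε₀ ε₂₉ B₃ B₃' a₀ a₁) p) → ∀ m, m < n →
      gOfRecord₁₃ F 2 (theta13OfThm1CCMW F 2 j γ ε₀ ε₂₉ B₃ B₃' a₀ a₁) p m ≤ gOfRecord₁₃ F 2 (theta13OfThm1CCMW F 2 j γ ε₀ ε₂₉ B₃ B₃' a₀ a₁) p (m + 1))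
    (hcompRev : ∀ (p : B12.RunParams) (n : ℕ), n ≤ p.K → Step.InInterval (theta13OfThm1CCMW F 2 j γ ε₀ ε₂₉ B₃ B₃' a₀ a₁).γ n (gOfRecord₁₃ F 2 (theta13OfThm1CCMW F 2 j γ ε₀ ε₂₉ B₃ B₃' a₀ a₁) p) → ∀ m, m < n →
      (theta13OfThm1CCMW F 2 j γ ε₀ ε₂₉ B₃ B₃' a₀ a₁).s2.cR * epsOfRecord (theta13OfThm1CCMW F 2 j γ ε₀ ε₂₉ B₃ B₃' a₀ a₁).ν (gOfRecord₁₃ F 2 (theta13OfThm1CCMW F 2 j γ ε₀ ε₂₉ B₃ B₃' a₀ a₁) p) (m + 1) ≤ 2 * ((theta13OfThm1CCMW F 2 j γ ε₀ ε₂₉ B₃ B₃' a₀ a₁).s2.cR * epsOfRecord (theta13OfThm1CCMW F 2 j γ ε₀ ε₂₉ B₃ B₃' a₀ a₁).ν (gOfRecord₁₃ F 2 (theta13OfThm1CCMW F 2 j γ ε₀ ε₂₉ B₃ B₃' a₀ a₁) p) m)) :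
    ∃ θ : Stage13HParams F 2, θ.Provisos₁₃SepCoPH F 2 ∧ (θ.ZhUnity F 2 ∧ θ.SlotsNondegenerate₁₃ F 2) ∧ θ.Admissible F 2 :=
  exists_k0SepCoPH_of_exists_k0SepCoPR (exists_k0SepCoPR_thm1CCMW_of_thm1GaugeR F hγ0 hγ hjm hε hε' hB hB' ha₀ ha₁ h15 hc h15G hmono hcompRev)

/-- **★★★★★★★ THE ⁷ K0 BODY AT THE WINDOW EDITION KEYED ON dag-n07-e's FLOOR-CARRYING STEP FACT AND THE TWO HISTORY CLAUSES**: from (8), `Gauge9RegSepTopStepGB F 2 suppDom (F.L ^ j) (floorGuard F c) (lamDatum F) (dataSmall7PTopOf F 2) B₃ B₃' a₀ a₁`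
(`c ≤ F.L ^ j`; `Record12BgRowCoClassGaugeRGuardedB` §3: minimal ⇒ critical on the `lamDatum`-fibre), the clauses at `θ₁₅ᶜᶜᴹ(j; γ)` and the signs, under `0 < γ ≤ ½`, `j + 1 ≤ F.m`.  The clauses are the DAG leaf's along-run shape
(`DagBinding.betaPositive`) — NODE O's input at its weakest.  CONDITIONAL; K0⁷ NOT closed here. [cite: Balaban1985Variational, (6)–(7) p.278, Thm 1 (8)–(9) p.279, (144)–(152) pp.300–301, Prop. 8 p.304; Balaban1985RegularSpaces, (1.3)–(1.9) p.77, Prop. 6 p.99; Balaban1988Convergent, Thm 1 p.262, (2.4)–(2.8) pp.255–256, (2.21) p.258, (3.16)–(3.23) pp.268–270; Balaban1987RG1, Thm 1 p.259, (0.20) p.256, (1.11)–(1.12) p.262; Balaban1989LargeFieldI, (0.2)–(0.4) p.176] -/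
theorem exists_k0SepCoPH_thm1CCMW_of_gauge9TopStepR (F : T4Family) (hγ0 : 0 < γ) (hγ : γ ≤ 1 / 2) (hjm : j + 1 ≤ F.m) (hε : 0 < ε₀) (hε' : 0 < ε₂₉) (hB : 0 ≤ B₃) (hB' : 0 ≤ B₃') (ha₀ : 0 < a₀)
    (ha₁ : 0 < a₁) (h15 : VariationalThm1RegSepCoP7MGB F 2 (floorGuard F c) (lamDatum F) (dataSmall7PTopOf F 2) B₃ a₀ a₁) (hc : c ≤ F.L ^ j)
    (h9 : Gauge9RegSepTopStepGB F 2 (fun ν K Ω => suppDomOfRecord F ν K Ω) (F.L ^ j) (floorGuard F c) (lamDatum F) (dataSmall7PTopOf F 2) B₃ B₃' a₀ a₁)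
    (hmono : ∀ (p : B12.RunParams) (n : ℕ), n ≤ p.K → Step.InInterval (theta13OfThm1CCMW F 2 j γ ε₀ ε₂₉ B₃ B₃' a₀ a₁).γ n (gOfRecord₁₃ F 2 (theta13OfThm1CCMW F 2 j γ ε₀ ε₂₉ B₃ B₃' a₀ a₁) p) → ∀ m, m < n →
      gOfRecord₁₃ F 2 (theta13OfThm1CCMW F 2 j γ ε₀ ε₂₉ B₃ B₃' a₀ a₁) p m ≤ gOfRecord₁₃ F 2 (theta13OfThm1CCMW F 2 j γ ε₀ ε₂₉ B₃ B₃' a₀ a₁) p (m + 1))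
    (hcompRev : ∀ (p : B12.RunParams) (n : ℕ), n ≤ p.K → Step.InInterval (theta13OfThm1CCMW F 2 j γ ε₀ ε₂₉ B₃ B₃' a₀ a₁).γ n (gOfRecord₁₃ F 2 (theta13OfThm1CCMW F 2 j γ ε₀ ε₂₉ B₃ B₃' a₀ a₁) p) → ∀ m, m < n →
      (theta13OfThm1CCMW F 2 j γ ε₀ ε₂₉ B₃ B₃' a₀ a₁).s2.cR * epsOfRecord (theta13OfThm1CCMW F 2 j γ ε₀ ε₂₉ B₃ B₃' a₀ a₁).ν (gOfRecord₁₃ F 2 (theta13OfThm1CCMW F 2 j γ ε₀ ε₂₉ B₃ B₃' a₀ a₁) p) (m + 1) ≤ 2 * ((theta13OfThm1CCMW F 2 j γ ε₀ ε₂₉ B₃ B₃' a₀ a₁).s2.cR * epsOfRecord (theta13OfThm1CCMW F 2 j γ ε₀ ε₂₉ B₃ B₃' a₀ a₁).ν (gOfRecord₁₃ F 2 (theta13OfThm1CCMW F 2 j γ ε₀ ε₂₉ B₃ B₃' a₀ a₁) p) m)) :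
    ∃ θ : Stage13HParams F 2, θ.Provisos₁₃SepCoPH F 2 ∧ (θ.ZhUnity F 2 ∧ θ.SlotsNondegenerate₁₃ F 2) ∧ θ.Admissible F 2 :=
  exists_k0SepCoPH_thm1CCMW_of_thm1GaugeR F hγ0 hγ hjm hε hε' hB hB' ha₀ ha₁ h15 hc (variationalThm1GaugeRegSepCoP7MGB_of_gauge9TopStepGB h9) hmono hcompRev

/-- **★ THE ⁷ K0 BODY AT THE WINDOW EDITION FROM THE β-BOX ON ITS OWN WINDOW `]0, γ]`** (`0 ≤ b`, 14d's letter `β′·γ² ≤ ¾`; history clauses by A2ʷ §6), keyed on the R step fact.  CONDITIONAL.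
[cite: Balaban1985Variational, Thm 1 (8)–(9) p.279, Prop. 8 p.304; Balaban1985RegularSpaces, Prop. 6 p.99; Balaban1988Convergent, Thm 1 p.262, (2.6)–(2.8) pp.255–256, (2.21) p.258, (3.16)–(3.23) pp.268–270; Balaban1987RG1, Thm 1 p.259, (0.20) p.256, §1 p.264; Balaban1989LargeFieldI, (0.2)–(0.4) p.176] -/
theorem exists_k0SepCoPH_thm1CCMW_of_gauge9TopStepR_of_betaBox (F : T4Family) (hγ0 : 0 < γ) (hγ : γ ≤ 1 / 2) (hjm : j + 1 ≤ F.m) (hε : 0 < ε₀) (hε' : 0 < ε₂₉) (hB : 0 ≤ B₃) (hB' : 0 ≤ B₃')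
    (ha₀ : 0 < a₀) (ha₁ : 0 < a₁) (h15 : VariationalThm1RegSepCoP7MGB F 2 (floorGuard F c) (lamDatum F) (dataSmall7PTopOf F 2) B₃ a₀ a₁) (hc : c ≤ F.L ^ j)
    (h9 : Gauge9RegSepTopStepGB F 2 (fun ν K Ω => suppDomOfRecord F ν K Ω) (F.L ^ j) (floorGuard F c) (lamDatum F) (dataSmall7PTopOf F 2) B₃ B₃' a₀ a₁)
    {b β' : ℝ} (hb : 0 ≤ b) (hlow : BetaLowerH b γ (betaOfRecord₁₃ F 2 (theta13OfThm1CCMW F 2 j γ ε₀ ε₂₉ B₃ B₃' a₀ a₁)))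
    (hup : BetaUpperH β' γ (betaOfRecord₁₃ F 2 (theta13OfThm1CCMW F 2 j γ ε₀ ε₂₉ B₃ B₃' a₀ a₁))) (hletter : β' * γ ^ 2 ≤ 3 / 4) :
    ∃ θ : Stage13HParams F 2, θ.Provisos₁₃SepCoPH F 2 ∧ (θ.ZhUnity F 2 ∧ θ.SlotsNondegenerate₁₃ F 2) ∧ θ.Admissible F 2 :=
  exists_k0SepCoPH_thm1CCMW_of_gauge9TopStepR F hγ0 hγ hjm hε hε' hB hB' ha₀ ha₁ h15 hc h9 (hmono_theta13OfThm1CCMW_of_betaLowerH hb hlow)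
    (hcompRev_theta13OfThm1CCMW_of_betaBox hγ hB hB' ha₀.le ha₁.le hb hlow hup hletter)

/-- **★★ THE ⁷ K0 BODY AT THE WINDOW EDITION FROM THE β-BOX OF A1's WITNESS `θ₁₅ᶜᶜᴹ(j)` ON THE SMALLER BOX `]0, γ]`** (`0 < γ ≤ ½`, `0 ≤ b`, `β′·γ² ≤ ¾`; A2ʷ §5 transfer), keyed on the R
step fact: the weakening of B's `exists_k0SepCoPH_of_thm1RegSepCoP7M_of_gauge9TopStepR_of_betaBox` from the box `½`, `β′ ≤ 3` to ANY box `]0, γ] ⊆ ]0, ½]`.  CONDITIONAL; K0⁷ NOT closed here.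
[cite: Balaban1985Variational, Thm 1 (8)–(9) p.279, Prop. 8 p.304; Balaban1985RegularSpaces, Prop. 6 p.99; Balaban1988Convergent, Thm 1 p.262, (2.6)–(2.8) pp.255–256, (2.21) p.258, (3.16)–(3.23) pp.268–270; Balaban1987RG1, Thm 1 p.259, (0.20) p.256, (1.20)–(1.22) p.264; Balaban1989LargeFieldII, (1.4) p.357; Balaban1989LargeFieldI, (0.2)–(0.4) p.176] -/
theorem exists_k0SepCoPH_thm1CCMW_of_gauge9TopStepR_of_betaBox_half (F : T4Family) (hγ0 : 0 < γ) (hγ : γ ≤ 1 / 2) (hjm : j + 1 ≤ F.m) (hε : 0 < ε₀) (hε' : 0 < ε₂₉) (hB : 0 ≤ B₃) (hB' : 0 ≤ B₃')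
    (ha₀ : 0 < a₀) (ha₁ : 0 < a₁) (h15 : VariationalThm1RegSepCoP7MGB F 2 (floorGuard F c) (lamDatum F) (dataSmall7PTopOf F 2) B₃ a₀ a₁) (hc : c ≤ F.L ^ j)
    (h9 : Gauge9RegSepTopStepGB F 2 (fun ν K Ω => suppDomOfRecord F ν K Ω) (F.L ^ j) (floorGuard F c) (lamDatum F) (dataSmall7PTopOf F 2) B₃ B₃' a₀ a₁)
    {b β' : ℝ} (hb : 0 ≤ b) (hlow : BetaLowerH b γ (betaOfRecord₁₃ F 2 (theta13OfThm1CCM F 2 j ε₀ ε₂₉ B₃ B₃' a₀ a₁)))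
    (hup : BetaUpperH β' γ (betaOfRecord₁₃ F 2 (theta13OfThm1CCM F 2 j ε₀ ε₂₉ B₃ B₃' a₀ a₁))) (hletter : β' * γ ^ 2 ≤ 3 / 4) :
    ∃ θ : Stage13HParams F 2, θ.Provisos₁₃SepCoPH F 2 ∧ (θ.ZhUnity F 2 ∧ θ.SlotsNondegenerate₁₃ F 2) ∧ θ.Admissible F 2 :=
  exists_k0SepCoPH_thm1CCMW_of_gauge9TopStepR_of_betaBox F hγ0 hγ hjm hε hε' hB hB' ha₀ ha₁ h15 hc h9 hb (betaLowerH_theta13OfThm1CCMW_of_half hγ hlow)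
    (betaUpperH_theta13OfThm1CCMW_of_half hγ hup) hletter

/-- **★ THE V15-FACING CUBE INSTANCE, β-BOX FORM** — at `j = 3`, `M = F.L ^ 3`, floor `c = (11·4 + 3·F.L)·F.L`, for families with `4 ≤ F.m`: the ⁷ body from (8), the R step fact at `(L³, (44+3L)L)`,
the signs, and the β-box of `betaOfRecord₁₃ F 2 θ₁₅ᶜᶜᴹ(3)` on SOME box `]0, γ] ⊆ ]0, ½]` with `0 ≤ b`, `β′·γ² ≤ ¾`.  CONDITIONAL. [cite: Balaban1985Variational, Thm 1 (8)–(9) p.279, (144)–(152) pp.300–301, Prop. 8 p.304; Balaban1985RegularSpaces, (1.3)–(1.6) p.77, Prop. 6 p.99, (1.130) p.99; Balaban1988Convergent, Thm 1 p.262, (2.12)–(2.13) pp.256–257, (3.16)–(3.23) pp.268–270; Balaban1987RG1, Thm 1 p.259, (0.1) p.251; Balaban1989LargeFieldI, (0.2)–(0.4) p.176] -/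
theorem exists_k0SepCoPH_thm1CCMW_of_gauge9TopStepR_of_betaBox_half_cube (F : T4Family) (hm : 4 ≤ F.m) (hγ0 : 0 < γ) (hγ : γ ≤ 1 / 2) (hε : 0 < ε₀) (hε' : 0 < ε₂₉) (hB : 0 ≤ B₃) (hB' : 0 ≤ B₃')
    (ha₀ : 0 < a₀) (ha₁ : 0 < a₁) (h15 : VariationalThm1RegSepCoP7MGB F 2 (floorGuard F ((11 * 4 + 3 * F.L) * F.L)) (lamDatum F) (dataSmall7PTopOf F 2) B₃ a₀ a₁)
    (h9 : Gauge9RegSepTopStepGB F 2 (fun ν K Ω => suppDomOfRecord F ν K Ω) (F.L ^ 3) (floorGuard F ((11 * 4 + 3 * F.L) * F.L)) (lamDatum F) (dataSmall7PTopOf F 2) B₃ B₃' a₀ a₁)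
    {b β' : ℝ} (hb : 0 ≤ b) (hlow : BetaLowerH b γ (betaOfRecord₁₃ F 2 (theta13OfThm1CCM F 2 3 ε₀ ε₂₉ B₃ B₃' a₀ a₁)))
    (hup : BetaUpperH β' γ (betaOfRecord₁₃ F 2 (theta13OfThm1CCM F 2 3 ε₀ ε₂₉ B₃ B₃' a₀ a₁))) (hletter : β' * γ ^ 2 ≤ 3 / 4) :
    ∃ θ : Stage13HParams F 2, θ.Provisos₁₃SepCoPH F 2 ∧ (θ.ZhUnity F 2 ∧ θ.SlotsNondegenerate₁₃ F 2) ∧ θ.Admissible F 2 :=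
  exists_k0SepCoPH_thm1CCMW_of_gauge9TopStepR_of_betaBox_half F (j := 3) hγ0 hγ hm hε hε' hB hB' ha₀ ha₁ h15
    ((theta13OfThm1CCM_M₁ F 2 3 ε₀ ε₂₉ B₃ B₃' a₀ a₁) ▸ collar_le_M₁_theta13OfThm1CCM F 2 ε₀ ε₂₉ B₃ B₃' a₀ a₁ (le_refl 3)) h9 hb hlow hup hletter

/-- **★ THE V15-FACING CUBE INSTANCE, HISTORY-CLAUSE FORM** — the same ⁷ body from (8), the R step fact at `(L³, (44+3L)L)`, the signs, and the two history clauses at `θ₁₅ᶜᶜᴹ(3; γ)` for SOME window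
`γ ∈ ]0, ½]` (the DAG leaf's along-run shape).  CONDITIONAL. [cite: Balaban1985Variational, Thm 1 (8)–(9) p.279, (144)–(152) pp.300–301, Prop. 8 p.304; Balaban1985RegularSpaces, (1.3)–(1.6) p.77, Prop. 6 p.99; Balaban1988Convergent, Thm 1 p.262, (2.6)–(2.8) pp.255–256, (3.16)–(3.23) pp.268–270; Balaban1987RG1, Thm 1 p.259, (0.20) p.256; Balaban1989LargeFieldI, (0.2)–(0.4) p.176] -/
theorem exists_k0SepCoPH_thm1CCMW_of_gauge9TopStepR_of_clauses_cube (F : T4Family) (hm : 4 ≤ F.m) (hγ0 : 0 < γ) (hγ : γ ≤ 1 / 2) (hε : 0 < ε₀) (hε' : 0 < ε₂₉) (hB : 0 ≤ B₃) (hB' : 0 ≤ B₃')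
    (ha₀ : 0 < a₀) (ha₁ : 0 < a₁) (h15 : VariationalThm1RegSepCoP7MGB F 2 (floorGuard F ((11 * 4 + 3 * F.L) * F.L)) (lamDatum F) (dataSmall7PTopOf F 2) B₃ a₀ a₁)
    (h9 : Gauge9RegSepTopStepGB F 2 (fun ν K Ω => suppDomOfRecord F ν K Ω) (F.L ^ 3) (floorGuard F ((11 * 4 + 3 * F.L) * F.L)) (lamDatum F) (dataSmall7PTopOf F 2) B₃ B₃' a₀ a₁)
    (hmono : ∀ (p : B12.RunParams) (n : ℕ), n ≤ p.K → Step.InInterval (theta13OfThm1CCMW F 2 3 γ ε₀ ε₂₉ B₃ B₃' a₀ a₁).γ n (gOfRecord₁₃ F 2 (theta13OfThm1CCMW F 2 3 γ ε₀ ε₂₉ B₃ B₃' a₀ a₁) p) → ∀ m, m < n →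
      gOfRecord₁₃ F 2 (theta13OfThm1CCMW F 2 3 γ ε₀ ε₂₉ B₃ B₃' a₀ a₁) p m ≤ gOfRecord₁₃ F 2 (theta13OfThm1CCMW F 2 3 γ ε₀ ε₂₉ B₃ B₃' a₀ a₁) p (m + 1))
    (hcompRev : ∀ (p : B12.RunParams) (n : ℕ), n ≤ p.K → Step.InInterval (theta13OfThm1CCMW F 2 3 γ ε₀ ε₂₉ B₃ B₃' a₀ a₁).γ n (gOfRecord₁₃ F 2 (theta13OfThm1CCMW F 2 3 γ ε₀ ε₂₉ B₃ B₃' a₀ a₁) p) → ∀ m, m < n →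
      (theta13OfThm1CCMW F 2 3 γ ε₀ ε₂₉ B₃ B₃' a₀ a₁).s2.cR * epsOfRecord (theta13OfThm1CCMW F 2 3 γ ε₀ ε₂₉ B₃ B₃' a₀ a₁).ν (gOfRecord₁₃ F 2 (theta13OfThm1CCMW F 2 3 γ ε₀ ε₂₉ B₃ B₃' a₀ a₁) p) (m + 1) ≤ 2 * ((theta13OfThm1CCMW F 2 3 γ ε₀ ε₂₉ B₃ B₃' a₀ a₁).s2.cR * epsOfRecord (theta13OfThm1CCMW F 2 3 γ ε₀ ε₂₉ B₃ B₃' a₀ a₁).ν (gOfRecord₁₃ F 2 (theta13OfThm1CCMW F 2 3 γ ε₀ ε₂₉ B₃ B₃' a₀ a₁) p) m)) :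
    ∃ θ : Stage13HParams F 2, θ.Provisos₁₃SepCoPH F 2 ∧ (θ.ZhUnity F 2 ∧ θ.SlotsNondegenerate₁₃ F 2) ∧ θ.Admissible F 2 :=
  exists_k0SepCoPH_thm1CCMW_of_gauge9TopStepR F (j := 3) hγ0 hγ hm hε hε' hB hB' ha₀ ha₁ h15
    ((theta13OfThm1CCMW_M₁ F 2 3 γ ε₀ ε₂₉ B₃ B₃' a₀ a₁) ▸ collar_le_M₁_theta13OfThm1CCMW F 2 γ ε₀ ε₂₉ B₃ B₃' a₀ a₁ (le_refl 3)) h9 hmono hcompRev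

end ClosersGaugeRW

end Literature.MathematicalPhysics.QuantumFieldTheory.Balaban1983to89.Node00

end
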